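import Summits.Ventures.PercRepro.RLSClosedForms

/-!
# C-025 at q = 3: closed forms of the t = 3 planar sums of the lifted rule R₃⁺ (night-3)

The top type `t = 3` (outside points `p − 3 = n + 1`, `p = n + 4`; the reduced world is exact there: `N` is free).  For the
line-free planes `U_{3,g}` the R₃⁺ supply needs the R₃ share sums of a triple / 4-set / 5-set,
`u0Sum n = Σ_x C(p−3,x)/C(x+3,3)`, `u1Sum n = Σ_x C(p−3,x)/C(x+4,3)`, `u2Sum n = Σ_x C(p−3,x)/C(x+5,3)`, and the witness count
`w3Sum n = Σ_x C(p−3,x) = 2^{p−3} − 2` (the hard-max share 1 of every subset with ≥ 6 points).  Closed forms as powers of 2 and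
binomials (`u0_closed`, `u1_closed`, `u2_closed` — the last through the two-level partial fraction
`1/C(i+6,3) = 1/C(i+4,3) − (3/2)/C(i+5,4) + (3/5)/C(i+6,5)`), and as explicit rational functions (`u0P`, `u1P`, `u2P`, `w3P`).
No `decide`, no tables.
-/

open PercRepro.NightThree.CF

namespace PercRepro.NightThree.U3

open Finset

/-- `Σ_{y<6} C(N,y)` spelled out. -/
theorem sum_range_six (N : ℕ) :
    (∑ y ∈ range 6, (N.choose y : ℚ)) = 1 + N + (N.choose 2 : ℚ) + (N.choose 3 : ℚ) + (N.choose 4 : ℚ) + (N.choose 5 : ℚ) := by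
  simp [sum_range_succ]

/-- `Σ_{y<1} C(N,y) = 1`. -/
theorem sum_range_one (N : ℕ) : (∑ y ∈ range 1, (N.choose y : ℚ)) = 1 := by simp

/-- The witness count at `t = 3`: `Σ_{x=1}^{p−4} C(p−3,x)`. -/
def w3Sum (n : ℕ) : ℚ := ∑ i ∈ range n, ((n + 1).choose (i + 1) : ℚ)

/-- `w3Sum n = 2^{n+1} − 2`. -/
theorem w3_closed (n : ℕ) : w3Sum n = 2 ^ (n + 1) - 2 := by
  unfold w3Sum
  rw [sum_choose_shift (n + 1) 1 n, sum_choose_Ico (n + 1) 1 (1 + n) (by omega) (by omega)]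
  have ht := sum_choose_tail (n + 1) 1 (by omega)
  rw [show n + 1 + 1 - 1 = 1 + n by omega] at ht
  rw [ht, sum_range_one]; ring

/-- The R₃ share sum of a triple at `t = 3`: `Σ_{x=1}^{p−4} C(p−3,x)/C(x+3,3)`. -/
def u0Sum (n : ℕ) : ℚ := ∑ i ∈ range n, ((n + 1).choose (i + 1) : ℚ) / ((i + 4).choose 3 : ℚ)

/-- `u0Sum n = (2^{n+4} − (1 + (n+4) + C(n+4,2) + C(n+4,3)) − 1) / C(n+4,3)`. -/
theorem u0_closed (n : ℕ) :
    u0Sum n = (2 ^ (n + 4) - (1 + ((n : ℚ) + 4) + ((n + 4).choose 2 : ℚ) + ((n + 4).choose 3 : ℚ)) - 1) / ((n + 4).choose 3 : ℚ) := by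
  have hpos : (((n + 4).choose 3 : ℕ) : ℚ) ≠ 0 := by exact_mod_cast (Nat.choose_pos (by omega)).ne'
  have hterm : ∀ i ∈ range n, ((n + 1).choose (i + 1) : ℚ) / ((i + 4).choose 3 : ℚ) =
      ((n + 4).choose (i + 4) : ℚ) / ((n + 4).choose 3 : ℚ) := by
    intro i _
    have hx : (((i + 4).choose 3 : ℕ) : ℚ) ≠ 0 := by exact_mod_cast (Nat.choose_pos (by omega)).ne'
    rw [div_eq_div_iff hx hpos]
    have h := Nat.choose_mul (n := n + 4) (k := i + 4) (s := 3) (by omega)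
    rw [show n + 4 - 3 = n + 1 by omega, show i + 4 - 3 = i + 1 by omega] at h
    have h' : ((n + 4).choose (i + 4) : ℚ) * ((i + 4).choose 3 : ℚ) = ((n + 4).choose 3 : ℚ) * ((n + 1).choose (i + 1) : ℚ) := by
      exact_mod_cast h
    linear_combination -h'
  unfold u0Sum
  rw [sum_congr rfl hterm, ← sum_div, sum_choose_shift (n + 4) 4 n, sum_choose_Ico (n + 4) 4 (4 + n) (by omega) (by omega)]
  have ht := sum_choose_tail (n + 4) 1 (by omega)
  rw [show n + 4 + 1 - 1 = 4 + n by omega] at ht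
  rw [ht, sum_range_four, sum_range_one]
  congr 1
  push_cast
  ring

/-- The R₃ share sum of a 4-set at `t = 3`: `Σ_{x=1}^{p−4} C(p−3,x)/C(x+4,3)`. -/
def u1Sum (n : ℕ) : ℚ := ∑ i ∈ range n, ((n + 1).choose (i + 1) : ℚ) / ((i + 5).choose 3 : ℚ)

/-- The R₃ share sum of a 5-set at `t = 3`: `Σ_{x=1}^{p−4} C(p−3,x)/C(x+5,3)`. -/
def u2Sum (n : ℕ) : ℚ := ∑ i ∈ range n, ((n + 1).choose (i + 1) : ℚ) / ((i + 6).choose 3 : ℚ)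

/-- The hard-max tie sum at `t = 3`: `Σ_{x=1}^{p−4} C(p−3,x)/(x+1)`. -/
def utieSum (n : ℕ) : ℚ := ∑ i ∈ range n, ((n + 1).choose (i + 1) : ℚ) / ((i : ℚ) + 2)

/-- `utieSum n = (2^{n+2} − (1 + (n+2)) − 1) / (n+2)`. -/
theorem utie_closed (n : ℕ) : utieSum n = (2 ^ (n + 2) - (1 + ((n : ℚ) + 2)) - 1) / ((n : ℚ) + 2) := by
  have hn : ((n : ℚ) + 2) ≠ 0 := by positivity
  have hterm : ∀ i ∈ range n, ((n + 1).choose (i + 1) : ℚ) / ((i : ℚ) + 2) =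
      ((n + 2).choose (i + 2) : ℚ) / ((n : ℚ) + 2) := by
    intro i _
    have hi : ((i : ℚ) + 2) ≠ 0 := by positivity
    rw [div_eq_div_iff hi hn]
    have h := Nat.add_one_mul_choose_eq (n + 1) (i + 1)
    rw [show n + 1 + 1 = n + 2 by omega, show i + 1 + 1 = i + 2 by omega] at h
    have h' : ((n : ℚ) + 2) * ((n + 1).choose (i + 1) : ℚ) = ((n + 2).choose (i + 2) : ℚ) * ((i : ℚ) + 2) := by
      exact_mod_cast h
    linear_combination h'
  unfold utieSum
  rw [sum_congr rfl hterm, ← sum_div, sum_choose_shift (n + 2) 2 n, sum_choose_Ico (n + 2) 2 (2 + n) (by omega) (by omega)]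
  have ht := sum_choose_tail (n + 2) 1 (by omega)
  rw [show n + 2 + 1 - 1 = 2 + n by omega] at ht
  rw [ht, sum_range_two, sum_range_one]
  congr 1
  push_cast
  ring

/-- `C(N,2) = N(N−1)/2` in `ℚ`. -/
theorem choose_two_cast (N : ℕ) : (N.choose 2 : ℚ) = (N : ℚ) * ((N : ℚ) - 1) / 2 := by
  induction N with
  | zero => simp
  | succ m ih =>
    rw [Nat.choose_succ_succ', Nat.choose_one_right]
    push_cast
    rw [ih]; ring

/-- `C(N,3) = N(N−1)(N−2)/6` in `ℚ`. -/
theorem choose_three_cast (N : ℕ) : (N.choose 3 : ℚ) = (N : ℚ) * ((N : ℚ) - 1) * ((N : ℚ) - 2) / 6 := by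
  induction N with
  | zero => simp
  | succ m ih =>
    rw [Nat.choose_succ_succ']
    push_cast
    rw [ih, choose_two_cast]; ring

/-- `C(N,4) = N(N−1)(N−2)(N−3)/24` in `ℚ`. -/
theorem choose_four_cast (N : ℕ) : (N.choose 4 : ℚ) = (N : ℚ) * ((N : ℚ) - 1) * ((N : ℚ) - 2) * ((N : ℚ) - 3) / 24 := by
  induction N with
  | zero => simp
  | succ m ih =>
    rw [Nat.choose_succ_succ']
    push_cast
    rw [ih, choose_three_cast]; ring


/-- `C(N,5) = N(N−1)(N−2)(N−3)(N−4)/120` in `ℚ`. -/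
theorem choose_five_cast (N : ℕ) :
    (N.choose 5 : ℚ) = (N : ℚ) * ((N : ℚ) - 1) * ((N : ℚ) - 2) * ((N : ℚ) - 3) * ((N : ℚ) - 4) / 120 := by
  induction N with
  | zero => simp
  | succ m ih =>
    rw [Nat.choose_succ_succ']
    push_cast
    rw [ih, choose_four_cast]; ring

/-- `1/C(i+5,3) = 1/C(i+4,3) − (3/4)/C(i+5,4)`. -/
theorem inv_choose_five (i : ℕ) :
    (1 : ℚ) / ((i + 5).choose 3 : ℚ) = 1 / ((i + 4).choose 3 : ℚ) - 3 / 4 * (1 / ((i + 5).choose 4 : ℚ)) := by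
  have e1 : ((i + 5).choose 3 : ℚ) = ((i : ℚ) + 5) * ((i : ℚ) + 4) * ((i : ℚ) + 3) / 6 := by
    rw [choose_three_cast]; push_cast; ring
  have e2 : ((i + 4).choose 3 : ℚ) = ((i : ℚ) + 4) * ((i : ℚ) + 3) * ((i : ℚ) + 2) / 6 := by
    rw [choose_three_cast]; push_cast; ring
  have e3 : ((i + 5).choose 4 : ℚ) = ((i : ℚ) + 5) * ((i : ℚ) + 4) * ((i : ℚ) + 3) * ((i : ℚ) + 2) / 24 := by
    rw [choose_four_cast]; push_cast; ring
  rw [e1, e2, e3]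
  have h1 : ((i : ℚ) + 2) ≠ 0 := by positivity
  have h2 : ((i : ℚ) + 3) ≠ 0 := by positivity
  have h3 : ((i : ℚ) + 4) ≠ 0 := by positivity
  have h4 : ((i : ℚ) + 5) ≠ 0 := by positivity
  field_simp
  ring

/-- `1/C(i+6,3) = 1/C(i+4,3) − (3/2)/C(i+5,4) + (3/5)/C(i+6,5)`. -/
theorem inv_choose_six (i : ℕ) :
    (1 : ℚ) / ((i + 6).choose 3 : ℚ) =
      1 / ((i + 4).choose 3 : ℚ) - 3 / 2 * (1 / ((i + 5).choose 4 : ℚ)) + 3 / 5 * (1 / ((i + 6).choose 5 : ℚ)) := by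
  have e1 : ((i + 6).choose 3 : ℚ) = ((i : ℚ) + 6) * ((i : ℚ) + 5) * ((i : ℚ) + 4) / 6 := by
    rw [choose_three_cast]; push_cast; ring
  have e2 : ((i + 4).choose 3 : ℚ) = ((i : ℚ) + 4) * ((i : ℚ) + 3) * ((i : ℚ) + 2) / 6 := by
    rw [choose_three_cast]; push_cast; ring
  have e3 : ((i + 5).choose 4 : ℚ) = ((i : ℚ) + 5) * ((i : ℚ) + 4) * ((i : ℚ) + 3) * ((i : ℚ) + 2) / 24 := by
    rw [choose_four_cast]; push_cast; ring
  have e4 : ((i + 6).choose 5 : ℚ) = ((i : ℚ) + 6) * ((i : ℚ) + 5) * ((i : ℚ) + 4) * ((i : ℚ) + 3) * ((i : ℚ) + 2) / 120 := by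
    rw [choose_five_cast]; push_cast; ring
  rw [e1, e2, e3, e4]
  have h1 : ((i : ℚ) + 2) ≠ 0 := by positivity
  have h2 : ((i : ℚ) + 3) ≠ 0 := by positivity
  have h3 : ((i : ℚ) + 4) ≠ 0 := by positivity
  have h4 : ((i : ℚ) + 5) ≠ 0 := by positivity
  have h5 : ((i : ℚ) + 6) ≠ 0 := by positivity
  field_simp
  ring

/-- `C(n+1,i+1)/C(i+5,4) = C(n+5,i+5)/C(n+5,4)`. -/
theorem ratio_four (n i : ℕ) : ((n + 1).choose (i + 1) : ℚ) / ((i + 5).choose 4 : ℚ) = ((n + 5).choose (i + 5) : ℚ) / ((n + 5).choose 4 : ℚ) := by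
  have hP : (((i + 5).choose 4 : ℕ) : ℚ) ≠ 0 := by exact_mod_cast (Nat.choose_pos (by omega)).ne'
  have hV : (((n + 5).choose 4 : ℕ) : ℚ) ≠ 0 := by exact_mod_cast (Nat.choose_pos (by omega)).ne'
  rw [div_eq_div_iff hP hV]
  have h := Nat.choose_mul (n := n + 5) (k := i + 5) (s := 4) (by omega)
  rw [show n + 5 - 4 = n + 1 by omega, show i + 5 - 4 = i + 1 by omega] at h
  have h' : ((n + 5).choose (i + 5) : ℚ) * ((i + 5).choose 4 : ℚ) = ((n + 5).choose 4 : ℚ) * ((n + 1).choose (i + 1) : ℚ) := by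
    exact_mod_cast h
  linear_combination -h'

/-- `C(n+1,i+1)/C(i+6,5) = C(n+6,i+6)/C(n+6,5)`. -/
theorem ratio_five (n i : ℕ) : ((n + 1).choose (i + 1) : ℚ) / ((i + 6).choose 5 : ℚ) = ((n + 6).choose (i + 6) : ℚ) / ((n + 6).choose 5 : ℚ) := by
  have hP : (((i + 6).choose 5 : ℕ) : ℚ) ≠ 0 := by exact_mod_cast (Nat.choose_pos (by omega)).ne'
  have hV : (((n + 6).choose 5 : ℕ) : ℚ) ≠ 0 := by exact_mod_cast (Nat.choose_pos (by omega)).ne'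
  rw [div_eq_div_iff hP hV]
  have h := Nat.choose_mul (n := n + 6) (k := i + 6) (s := 5) (by omega)
  rw [show n + 6 - 5 = n + 1 by omega, show i + 6 - 5 = i + 1 by omega] at h
  have h' : ((n + 6).choose (i + 6) : ℚ) * ((i + 6).choose 5 : ℚ) = ((n + 6).choose 5 : ℚ) * ((n + 1).choose (i + 1) : ℚ) := by
    exact_mod_cast h
  linear_combination -h'

/-- `Σ_{i<n} C(n+5,i+5) = 2^{n+5} − Σ_{y<5} C(n+5,y) − 1`. -/
theorem sum_level_five (n : ℕ) :
    (∑ i ∈ range n, ((n + 5).choose (i + 5) : ℚ)) =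
      2 ^ (n + 5) - (1 + ((n : ℚ) + 5) + ((n + 5).choose 2 : ℚ) + ((n + 5).choose 3 : ℚ) + ((n + 5).choose 4 : ℚ)) - 1 := by
  rw [sum_choose_shift (n + 5) 5 n, sum_choose_Ico (n + 5) 5 (5 + n) (by omega) (by omega)]
  have ht := sum_choose_tail (n + 5) 1 (by omega)
  rw [show n + 5 + 1 - 1 = 5 + n by omega] at ht
  rw [ht, sum_range_five, sum_range_one]; push_cast; ring

/-- `Σ_{i<n} C(n+6,i+6) = 2^{n+6} − Σ_{y<6} C(n+6,y) − 1`. -/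
theorem sum_level_six (n : ℕ) :
    (∑ i ∈ range n, ((n + 6).choose (i + 6) : ℚ)) =
      2 ^ (n + 6) - (1 + ((n : ℚ) + 6) + ((n + 6).choose 2 : ℚ) + ((n + 6).choose 3 : ℚ) + ((n + 6).choose 4 : ℚ) + ((n + 6).choose 5 : ℚ)) - 1 := by
  rw [sum_choose_shift (n + 6) 6 n, sum_choose_Ico (n + 6) 6 (6 + n) (by omega) (by omega)]
  have ht := sum_choose_tail (n + 6) 1 (by omega)
  rw [show n + 6 + 1 - 1 = 6 + n by omega] at ht
  rw [ht, sum_range_six, sum_range_one]; push_cast; ring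

/-- `u1Sum n = u0Sum n − (3/4)·(Σ_{i<n} C(n+5,i+5)) / C(n+5,4)`. -/
theorem u1_closed (n : ℕ) :
    u1Sum n = u0Sum n - 3 / 4 * ((2 ^ (n + 5) - (1 + ((n : ℚ) + 5) + ((n + 5).choose 2 : ℚ) + ((n + 5).choose 3 : ℚ)
      + ((n + 5).choose 4 : ℚ)) - 1) / ((n + 5).choose 4 : ℚ)) := by
  unfold u1Sum u0Sum
  have hterm : ∀ i ∈ range n, ((n + 1).choose (i + 1) : ℚ) / ((i + 5).choose 3 : ℚ) =
      ((n + 1).choose (i + 1) : ℚ) / ((i + 4).choose 3 : ℚ) - 3 / 4 * (((n + 5).choose (i + 5) : ℚ) / ((n + 5).choose 4 : ℚ)) := by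
    intro i _
    rw [← ratio_four, div_eq_mul_one_div, inv_choose_five]; ring
  rw [sum_congr rfl hterm, sum_sub_distrib, ← mul_sum, ← sum_div, sum_level_five]

/-- `u2Sum n = u0Sum n − (3/2)·(Σ C(n+5,i+5))/C(n+5,4) + (3/5)·(Σ C(n+6,i+6))/C(n+6,5)`. -/
theorem u2_closed (n : ℕ) :
    u2Sum n = u0Sum n - 3 / 2 * ((2 ^ (n + 5) - (1 + ((n : ℚ) + 5) + ((n + 5).choose 2 : ℚ) + ((n + 5).choose 3 : ℚ)
      + ((n + 5).choose 4 : ℚ)) - 1) / ((n + 5).choose 4 : ℚ)) + 3 / 5 * ((2 ^ (n + 6) - (1 + ((n : ℚ) + 6) + ((n + 6).choose 2 : ℚ)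
      + ((n + 6).choose 3 : ℚ) + ((n + 6).choose 4 : ℚ) + ((n + 6).choose 5 : ℚ)) - 1) / ((n + 6).choose 5 : ℚ)) := by
  unfold u2Sum u0Sum
  have hterm : ∀ i ∈ range n, ((n + 1).choose (i + 1) : ℚ) / ((i + 6).choose 3 : ℚ) =
      ((n + 1).choose (i + 1) : ℚ) / ((i + 4).choose 3 : ℚ) - 3 / 2 * (((n + 5).choose (i + 5) : ℚ) / ((n + 5).choose 4 : ℚ))
        + 3 / 5 * (((n + 6).choose (i + 6) : ℚ) / ((n + 6).choose 5 : ℚ)) := by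
    intro i _
    rw [← ratio_four, ← ratio_five, div_eq_mul_one_div, inv_choose_six]; ring
  rw [sum_congr rfl hterm, sum_add_distrib, sum_sub_distrib, ← mul_sum, ← mul_sum, ← sum_div, ← sum_div, sum_level_five, sum_level_six]

/-! ## Polynomial forms -/

/-- `Φ(p,3)` as a rational function of `n` and `2^n`. -/
def phiP (n : ℕ) : ℚ :=
  (128 * 2 ^ n - 2 * (1 + ((n : ℚ) + 7) + ((n : ℚ) + 7) * ((n : ℚ) + 6) / 2 + ((n : ℚ) + 7) * ((n : ℚ) + 6) * ((n : ℚ) + 5) / 6)) /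
    (((n : ℚ) + 7) * ((n : ℚ) + 6) * ((n : ℚ) + 5) / 6)


/-- `u0Sum` as a rational function. -/
def u0P (n : ℕ) : ℚ :=
  (16 * 2 ^ n - (1 + ((n : ℚ) + 4) + ((n : ℚ) + 4) * ((n : ℚ) + 3) / 2 + ((n : ℚ) + 4) * ((n : ℚ) + 3) * ((n : ℚ) + 2) / 6) - 1) /
    (((n : ℚ) + 4) * ((n : ℚ) + 3) * ((n : ℚ) + 2) / 6)

/-- `(Σ C(n+5,i+5))/C(n+5,4)` as a rational function. -/
def v5P (n : ℕ) : ℚ :=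
  (32 * 2 ^ n - (1 + ((n : ℚ) + 5) + ((n : ℚ) + 5) * ((n : ℚ) + 4) / 2 + ((n : ℚ) + 5) * ((n : ℚ) + 4) * ((n : ℚ) + 3) / 6
      + ((n : ℚ) + 5) * ((n : ℚ) + 4) * ((n : ℚ) + 3) * ((n : ℚ) + 2) / 24) - 1) /
    (((n : ℚ) + 5) * ((n : ℚ) + 4) * ((n : ℚ) + 3) * ((n : ℚ) + 2) / 24)

/-- `(Σ C(n+6,i+6))/C(n+6,5)` as a rational function. -/
def v6P (n : ℕ) : ℚ :=
  (64 * 2 ^ n - (1 + ((n : ℚ) + 6) + ((n : ℚ) + 6) * ((n : ℚ) + 5) / 2 + ((n : ℚ) + 6) * ((n : ℚ) + 5) * ((n : ℚ) + 4) / 6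
      + ((n : ℚ) + 6) * ((n : ℚ) + 5) * ((n : ℚ) + 4) * ((n : ℚ) + 3) / 24
      + ((n : ℚ) + 6) * ((n : ℚ) + 5) * ((n : ℚ) + 4) * ((n : ℚ) + 3) * ((n : ℚ) + 2) / 120) - 1) /
    (((n : ℚ) + 6) * ((n : ℚ) + 5) * ((n : ℚ) + 4) * ((n : ℚ) + 3) * ((n : ℚ) + 2) / 120)

/-- `u1Sum` as a rational function. -/
def u1P (n : ℕ) : ℚ := u0P n - 3 / 4 * v5P n

/-- `u2Sum` as a rational function. -/
def u2P (n : ℕ) : ℚ := u0P n - 3 / 2 * v5P n + 3 / 5 * v6P n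

/-- `w3Sum` as a rational function. -/
def w3P (n : ℕ) : ℚ := 2 * 2 ^ n - 2

/-- `phiClosed` as an explicit rational function of `n` and `2^n`. -/
theorem phiClosed_eq_phiP (n : ℕ) : phiClosed n = phiP n := by
  unfold phiClosed phiP
  rw [choose_three_cast, choose_two_cast]
  push_cast
  rw [pow_add]
  ring_nf


/-- `u0Sum` as an explicit rational function. -/
theorem u0_eq_u0P (n : ℕ) : u0Sum n = u0P n := by
  rw [u0_closed]; unfold u0P
  rw [choose_three_cast, choose_two_cast]
  push_cast
  rw [pow_add]
  ring_nf

/-- `u1Sum` as an explicit rational function. -/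
theorem u1_eq_u1P (n : ℕ) : u1Sum n = u1P n := by
  rw [u1_closed, u0_eq_u0P]; unfold u1P v5P
  rw [choose_four_cast, choose_three_cast, choose_two_cast]
  push_cast
  rw [pow_add]
  ring_nf

/-- `u2Sum` as an explicit rational function. -/
theorem u2_eq_u2P (n : ℕ) : u2Sum n = u2P n := by
  rw [u2_closed, u0_eq_u0P]; unfold u2P v5P v6P
  rw [choose_five_cast, choose_four_cast, choose_four_cast, choose_three_cast, choose_three_cast, choose_two_cast, choose_two_cast]
  push_cast
  rw [pow_add, pow_add]
  ring_nf

/-- `w3Sum` as an explicit rational function. -/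
theorem w3_eq_w3P (n : ℕ) : w3Sum n = w3P n := by
  rw [w3_closed]; unfold w3P; rw [pow_add]; ring


/-- `utieSum` as a rational function. -/
def utieP (n : ℕ) : ℚ := (4 * 2 ^ n - (1 + ((n : ℚ) + 2)) - 1) / ((n : ℚ) + 2)

/-- `utieSum` as an explicit rational function. -/
theorem utie_eq_P (n : ℕ) : utieSum n = utieP n := by
  rw [utie_closed]; unfold utieP
  rw [pow_add]
  ring_nf

end PercRepro.NightThree.U3
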